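import Literature.MathematicalPhysics.QuantumLattice.HubbardTTPrimeTorusFreeEnergyConcavity
import HarnessLib

/-!
# `β F_β` is jointly concave in the inverse temperature and the couplings: transport of certified
# `log`-partition-function bounds across TEMPERATURE × COUPLING cells

Topic `Literature/MathematicalPhysics/QuantumLattice` (thermal toolkit; third file of the coupling-transport
layer `GibbsFreeEnergyCouplingConcavity` (convexity of `H ↦ log Z_β(H)`, Peierls–Bogoliubov tangents and
bracket, affine families) / `HubbardTTPrimeTorusFreeEnergyConcavity` (the `t–t'` Hubbard torus,
grand-canonical and canonical sector); companion of `GibbsPressureTemperature` (convexity of `β ↦ log Z_β(H)`,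
supporting line `log Z_{β'} − (β − β')⟨H⟩_{β'} ≤ log Z_β`)). Written for the phase-map cells of the Hubbard
material oracle, which are products of a TEMPERATURE interval and a COUPLING box (stage S2 (iii) × S2 (i)):
the two one-parameter convexities (in `β` at fixed couplings, in the couplings at fixed `β`) are faces of
ONE joint statement. With the temperature absorbed into the interaction (Israel's convention
`P(Φ) = log tr e^{−H(Φ)}`, `Z_β(H) = Z_1(βH)`), `log Z_β(H(x)) = log Z_1(H(β x))` for a LINEAR family
`x ↦ H(x)` of Hamiltonians, and `c ↦ log Z_1(H(c))` is convex: so `(β, x) ↦ −β F_β(x) = log Z_β(H(x))` is a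
convex function of the SCALED COUPLINGS `c = β x`. Consequences, everything PROVED for Hermitian matrix
families on a nonempty finite index type (no definition, no named fact, no number):

* §1 `gibbsWeight_one_real_smul`, `partitionFn_one_real_smul`, `gibbsState_one_real_smul` — `e^{−1·(βH)} =
  e^{−βH}`, `Z_1(βH) = Z_β(H)`, `⟨·⟩_{1,βH} = ⟨·⟩_{β,H}`.
* §2 LINEAR families `H : E → Matrix` over a real vector space (`H(a x + b y) = a H(x) + b H(y)` for all
  real `a, b`): `log_partitionFn_linear_eq_one` (`log Z_β(H x) = log Z_1(H(β • x))`);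
  **`log_partitionFn_linear_le_sum_temperature`** — JENSEN ACROSS TEMPERATURES AND COUPLINGS: if the scaled
  target `β • x` is a convex combination `Σ wₖ • (βₖ • xₖ)` of scaled corners, then
  `log Z_β(H x) ≤ Σ wₖ log Z_{βₖ}(H xₖ)` — certified `log Z` CAPS (free-energy floors `βₖ F ≥ −uₖ`) at the
  corners `(βₖ, xₖ)` of a temperature × coupling cell cap `log Z` inside (a `(β, x)`-cell is covered by
  the scaled corners since `β • x = λ β₁ • x + (1−λ) β₂ • x` and each `βᵢ • x` lies in the scaled box of
  `βᵢ`); **`log_partitionFn_linear_ge_tangent_temperature`** — the JOINT TANGENT PLANE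
  `log Z_β(H x) ≥ log Z_{β₀}(H x₀) − Re⟨β H x − β₀ H x₀⟩_{β₀, H x₀}`: ONE anchor `(β₀, x₀)` with its thermal
  expectations floors `log Z` (caps `βF`) at every temperature and coupling; at `x = x₀` it is the
  tree's supporting line in `β` (`log_partitionFn_sub_mul_energy_le`), at `β = β₀` the coupling tangent of
  `GibbsFreeEnergyCouplingConcavity`.
* §3 COORDINATE families `θ ↦ Σₐ θₐ Dₐ` (`θ : ι → ℝ`): `convexOn_log_partitionFn_one_linear` (joint convexity
  in all coefficients `cₐ = βθₐ`), the slope form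
  `log Z_β(θ) ≥ log Z_{β₀}(θ₀) − Σₐ (βθₐ − β₀θ₀ₐ) Re⟨Dₐ⟩_{β₀,θ₀}` (`log_partitionFn_coord_ge_tangent_temperature`)
  and its certified reading with a floor at the anchor and slope WINDOWS
  (`log_partitionFn_coord_ge_of_slopes_mem_Icc_temperature`, sign-split).
* §4 THE `t–t'` HUBBARD TORUS (grand-canonical `H_L(t,t',U) − μN`, linear in `(t,t',U,μ)`, and the canonical
  sector compression `sectorHamiltonianTT'`, linear in `(t,t',U)`): the joint tangent planes
  `log_partitionFn_hubbardTorusTT'_ge_tangent_temperature` (slopes: thermal nearest-neighbour / diagonal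
  hopping energies, double occupancy, particle number of the anchor, multiplying the SCALED increments
  `βt − β₀t₀, …`) and `log_partitionFn_sectorHamiltonianTT'_ge_tangent_temperature`, and the Jensen caps
  `log_partitionFn_hubbardTorusTT'_le_sum_temperature` / `log_partitionFn_sectorHamiltonianTT'_le_sum_temperature`
  over the corners of a temperature × coupling cell.

HONEST SCOPE: finite volume; transport lemmas only; no certificate, no number, no thermodynamic limit, no
phase sentence. The thermal energy itself is transported only through these `log Z` bounds (chords of
`GibbsVariationalPrinciple` / `TorusSectorGibbsEnergyWindow`).

## Mathlib / tree search
REUSED: `convexOn_log_partitionFn_affine`, `convexOn_log_partitionFn_coord`,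
`log_partitionFn_sub_le_log_partitionFn_add` (via the bracket lemmas), `hubbardTorusTT'_eq_smul_add`,
`hubbardTorusTT'_sub_mu_smul_add_smul`, `isHermitian_hubbardTorusTT'_sub_mu`, `sectorHamiltonianTT'_eq_smul_add`,
`sectorHamiltonianTT'_smul_add_smul`, `isHermitian_sectorHamiltonianTT'`, `nonempty_szConfig`. Not restated:
`log_partitionFn_sub_mul_energy_le` (`GibbsPressureTemperature`, the `x = x₀` face).
`lean search 'partitionFn 1 |partitionFn_one_smul|gibbsWeight_one'` → nothing: the scaling identities are new.

## References
* R. B. Israel, *Convexity in the Theory of Lattice Gases* (1979), §I.3 (the pressure `P(Φ) =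
  lim |Λ|⁻¹ log tr e^{−H_Λ(Φ)}`, temperature absorbed in `Φ`) and Theorem I.3.4 (`P` is convex on the
  whole Banach space of interactions — jointly in temperature and couplings). [cite: Israel1979, Thm. I.3.4]
* E. H. Lieb, Commun. Math. Phys. 31 (1973) 327–340, §V (5.2)–(5.4) (Peierls–Bogoliubov tangent).
  [cite: Lieb1973, §V (5.2)–(5.4)]
-/

noncomputable section

open scoped Matrix.Norms.L2Operator ComplexOrder BigOperators
open Matrix Finset

namespace Literature.MathematicalPhysics.QuantumLattice

variable {n : Type*} [Fintype n] [DecidableEq n]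

/-! ### §1 Absorbing the temperature into the Hamiltonian -/

section Scaling

/-- `e^{−1·(βH)} = e^{−βH}`. [cite: Israel1979, §I.3] -/
theorem gibbsWeight_one_real_smul (β : ℝ) (H : Matrix n n ℂ) :
    gibbsWeight 1 ((β : ℂ) • H) = gibbsWeight β H := by
  simp only [gibbsWeight, smul_smul, Complex.ofReal_one, neg_one_mul]

/-- **`Z_1(βH) = Z_β(H)`**: the inverse temperature is a scaling of the Hamiltonian. [cite: Israel1979, §I.3] -/
theorem partitionFn_one_real_smul (β : ℝ) (H : Matrix n n ℂ) :
    partitionFn 1 ((β : ℂ) • H) = partitionFn β H := by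
  rw [partitionFn, partitionFn, gibbsWeight_one_real_smul]

/-- `⟨·⟩_{1, βH} = ⟨·⟩_{β, H}`. [cite: Israel1979, §I.3] -/
theorem gibbsState_one_real_smul (β : ℝ) (H : Matrix n n ℂ) :
    gibbsState 1 ((β : ℂ) • H) = gibbsState β H := by
  ext A
  rw [gibbsState_apply, gibbsState_apply, partitionFn_one_real_smul, gibbsWeight_one_real_smul]

end Scaling

/-! ### §2 Linear families over a real vector space of couplings: joint statements in `(β, x)` -/

section Linear

variable {E : Type*} [AddCommGroup E] [Module ℝ E] {H : E → Matrix n n ℂ}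

omit [Fintype n] [DecidableEq n] in
/-- A linear family scales: `H(r • x) = r H(x)`. [cite: Israel1979, §I.3] -/
theorem linearFamily_smul
    (hH : ∀ (x y : E) (a b : ℝ), H (a • x + b • y) = (a : ℂ) • H x + (b : ℂ) • H y) (r : ℝ) (x : E) :
    H (r • x) = (r : ℂ) • H x := by
  have h := hH x x r 0
  rwa [zero_smul, add_zero, Complex.ofReal_zero, zero_smul, add_zero] at h

/-- **`log Z_β(H x) = log Z_1(H(β • x))`** for a linear family: temperature and couplings enter only
through the scaled coupling `β • x`. [cite: Israel1979, §I.3] -/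
theorem log_partitionFn_linear_eq_one
    (hH : ∀ (x y : E) (a b : ℝ), H (a • x + b • y) = (a : ℂ) • H x + (b : ℂ) • H y) (β : ℝ) (x : E) :
    Real.log (partitionFn β (H x)).re = Real.log (partitionFn 1 (H (β • x))).re := by
  rw [linearFamily_smul hH, partitionFn_one_real_smul]

/-- **Jensen across temperatures and couplings.** For a linear Hermitian family, corners `(βₖ, xₖ)`, convex
weights `wₖ` and a target `(β, x)` whose SCALED coupling is the barycentre of the scaled corners,
`β • x = Σ wₖ • (βₖ • xₖ)`: `log Z_β(H x) ≤ Σ wₖ log Z_{βₖ}(H xₖ)`. Certified `log Z` caps at the corners of a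
temperature × coupling cell cap `log Z` (floor `βF`) inside. [cite: Israel1979, Thm. I.3.4] -/
theorem log_partitionFn_linear_le_sum_temperature [Nonempty n]
    (hH : ∀ (x y : E) (a b : ℝ), H (a • x + b • y) = (a : ℂ) • H x + (b : ℂ) • H y)
    (hHh : ∀ x, (H x).IsHermitian) {κ : Type*} (s : Finset κ) (w : κ → ℝ) (βk : κ → ℝ) (xk : κ → E)
    (hw : ∀ k ∈ s, 0 ≤ w k) (hw1 : ∑ k ∈ s, w k = 1) {β : ℝ} {x : E}
    (hc : β • x = ∑ k ∈ s, w k • (βk k • xk k)) :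
    Real.log (partitionFn β (H x)).re ≤ ∑ k ∈ s, w k * Real.log (partitionFn (βk k) (H (xk k))).re := by
  rw [log_partitionFn_linear_eq_one hH, hc]
  have h := (convexOn_log_partitionFn_affine (fun x y a b _ => hH x y a b) hHh 1).map_sum_le
    (p := fun k => βk k • xk k) hw hw1 (fun _ _ => Set.mem_univ _)
  simp only [smul_eq_mul] at h
  refine h.trans (le_of_eq (Finset.sum_congr rfl fun k _ => ?_))
  rw [← log_partitionFn_linear_eq_one hH]

/-- **Certified form**: caps `log Z_{βₖ}(H xₖ) ≤ uₖ` at the corners give `log Z_β(H x) ≤ Σ wₖ uₖ` at the scaled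
barycentre. [cite: Israel1979, Thm. I.3.4] -/
theorem log_partitionFn_linear_le_sum_of_le_temperature [Nonempty n]
    (hH : ∀ (x y : E) (a b : ℝ), H (a • x + b • y) = (a : ℂ) • H x + (b : ℂ) • H y)
    (hHh : ∀ x, (H x).IsHermitian) {κ : Type*} (s : Finset κ) (w : κ → ℝ) (βk : κ → ℝ) (xk : κ → E)
    (u : κ → ℝ) (hw : ∀ k ∈ s, 0 ≤ w k) (hw1 : ∑ k ∈ s, w k = 1) {β : ℝ} {x : E}
    (hc : β • x = ∑ k ∈ s, w k • (βk k • xk k))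
    (hu : ∀ k ∈ s, Real.log (partitionFn (βk k) (H (xk k))).re ≤ u k) :
    Real.log (partitionFn β (H x)).re ≤ ∑ k ∈ s, w k * u k :=
  (log_partitionFn_linear_le_sum_temperature hH hHh s w βk xk hw hw1 hc).trans
    (Finset.sum_le_sum fun k hk => mul_le_mul_of_nonneg_left (hu k hk) (hw k hk))

/-- **The joint tangent plane in `(β, x)`** for a linear Hermitian family:
`log Z_{β₀}(H x₀) − Re⟨β H x − β₀ H x₀⟩_{β₀, H x₀} ≤ log Z_β(H x)` — the Peierls–Bogoliubov tangent of the convex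
`c ↦ log Z_1(H c)` at the scaled anchor `β₀ • x₀`, read at `β • x`. [cite: Lieb1973, §V (5.2)–(5.4)] -/
theorem log_partitionFn_linear_ge_tangent_temperature [Nonempty n]
    (hH : ∀ (x y : E) (a b : ℝ), H (a • x + b • y) = (a : ℂ) • H x + (b : ℂ) • H y)
    (hHh : ∀ x, (H x).IsHermitian) (β β₀ : ℝ) (x x₀ : E) :
    Real.log (partitionFn β₀ (H x₀)).re -
        (gibbsState β₀ (H x₀) ((β : ℂ) • H x - (β₀ : ℂ) • H x₀)).re ≤
      Real.log (partitionFn β (H x)).re := by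
  rw [log_partitionFn_linear_eq_one hH β, log_partitionFn_linear_eq_one hH β₀, ← gibbsState_one_real_smul β₀,
    ← linearFamily_smul hH β, ← linearFamily_smul hH β₀]
  have h := log_partitionFn_sub_le_mul_re_gibbsState (hHh (β₀ • x₀)) ((hHh (β • x)).sub (hHh (β₀ • x₀))) 1
  rw [add_sub_cancel, one_mul] at h
  linarith

end Linear

/-! ### §3 Coordinate families `θ ↦ Σₐ θₐ Dₐ`: slope form -/

section Coord

variable {ι : Type*} [Fintype ι] {D : ι → Matrix n n ℂ}

omit [Fintype n] [DecidableEq n] in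
/-- Coordinate families without constant term are linear. [cite: Israel1979, §I.3] -/
private theorem linearFamily_coord (D : ι → Matrix n n ℂ) (θ θ' : ι → ℝ) (a b : ℝ) :
    ∑ c, (((a • θ + b • θ') c : ℝ) : ℂ) • D c =
      (a : ℂ) • ∑ c, ((θ c : ℝ) : ℂ) • D c + (b : ℂ) • ∑ c, ((θ' c : ℝ) : ℂ) • D c := by
  rw [Finset.smul_sum, Finset.smul_sum, ← Finset.sum_add_distrib]
  refine Finset.sum_congr rfl fun c _ => ?_
  simp only [Pi.add_apply, Pi.smul_apply, smul_eq_mul, Complex.ofReal_add, Complex.ofReal_mul, add_smul,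
    mul_smul]

omit [Fintype n] [DecidableEq n] in
/-- Coordinate families with Hermitian directions are Hermitian. [cite: Israel1979, §I.3] -/
private theorem isHermitian_coord (hD : ∀ a, (D a).IsHermitian) (θ : ι → ℝ) :
    (∑ a, ((θ a : ℝ) : ℂ) • D a).IsHermitian := by
  unfold Matrix.IsHermitian
  rw [conjTranspose_sum]
  exact Finset.sum_congr rfl fun a _ => (isHermitian_real_smul (hD a) (θ a)).eq

/-- **Joint convexity in all coefficients**: `c ↦ log tr exp(−Σₐ cₐ Dₐ)` is convex on `ι → ℝ`; with
`cₐ = βθₐ` this is the joint convexity of `(β, θ) ↦ −βF_β(θ)` in the scaled couplings.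
[cite: Israel1979, Thm. I.3.4] -/
theorem convexOn_log_partitionFn_one_linear [Nonempty n] (hD : ∀ a, (D a).IsHermitian) :
    ConvexOn ℝ Set.univ (fun c : ι → ℝ => Real.log (partitionFn 1 (∑ a, ((c a : ℝ) : ℂ) • D a)).re) := by
  have h := convexOn_log_partitionFn_coord (H₀ := (0 : Matrix n n ℂ)) isHermitian_zero hD (1 : ℝ)
  simpa only [zero_add] using h

/-- **The joint tangent plane in slope form**:
`log Z_{β₀}(Σ θ₀ₐDₐ) − Σₐ (βθₐ − β₀θ₀ₐ) Re⟨Dₐ⟩_{β₀,θ₀} ≤ log Z_β(Σ θₐDₐ)` — slopes are the anchor's thermal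
expectations of the directions, increments are increments of the SCALED couplings `βθₐ`.
[cite: Lieb1973, §V (5.2)–(5.4)] -/
theorem log_partitionFn_coord_ge_tangent_temperature [Nonempty n] (hD : ∀ a, (D a).IsHermitian)
    (β β₀ : ℝ) (θ θ₀ : ι → ℝ) :
    Real.log (partitionFn β₀ (∑ a, ((θ₀ a : ℝ) : ℂ) • D a)).re -
        ∑ a, (β * θ a - β₀ * θ₀ a) * (gibbsState β₀ (∑ a, ((θ₀ a : ℝ) : ℂ) • D a) (D a)).re ≤
      Real.log (partitionFn β (∑ a, ((θ a : ℝ) : ℂ) • D a)).re := by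
  have h := log_partitionFn_linear_ge_tangent_temperature
    (H := fun θ : ι → ℝ => ∑ a, ((θ a : ℝ) : ℂ) • D a) (fun θ θ' a b => linearFamily_coord D θ θ' a b)
    (isHermitian_coord hD) β β₀ θ θ₀
  have hW : (β : ℂ) • (∑ a, ((θ a : ℝ) : ℂ) • D a) - (β₀ : ℂ) • (∑ a, ((θ₀ a : ℝ) : ℂ) • D a) =
      ∑ a, (((β * θ a - β₀ * θ₀ a : ℝ)) : ℂ) • D a := by
    simp only [Finset.smul_sum, smul_smul, ← Finset.sum_sub_distrib, ← sub_smul, Complex.ofReal_sub,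
      Complex.ofReal_mul]
  rw [hW, map_sum, Complex.re_sum] at h
  have hre : ∀ a, (gibbsState β₀ (∑ a, ((θ₀ a : ℝ) : ℂ) • D a) ((((β * θ a - β₀ * θ₀ a : ℝ)) : ℂ) • D a)).re =
      (β * θ a - β₀ * θ₀ a) * (gibbsState β₀ (∑ a, ((θ₀ a : ℝ) : ℂ) • D a) (D a)).re := fun a => by
    rw [map_smul, smul_eq_mul, Complex.re_ofReal_mul]
  simp only [hre] at h
  exact h

/-- **Certified joint tangent**: a certified FLOOR `ℓ₀ ≤ log Z_{β₀}(Σθ₀ₐDₐ)` at the anchor and certified slope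
WINDOWS `loₐ ≤ Re⟨Dₐ⟩_{β₀,θ₀} ≤ hiₐ` give, at EVERY temperature `β` and coupling `θ`,
`ℓ₀ − Σₐ max ((βθₐ − β₀θ₀ₐ) loₐ) ((βθₐ − β₀θ₀ₐ) hiₐ) ≤ log Z_β(ΣθₐDₐ)` — interval arithmetic only.
[cite: Lieb1973, §V (5.2)–(5.4)] -/
theorem log_partitionFn_coord_ge_of_slopes_mem_Icc_temperature [Nonempty n] (hD : ∀ a, (D a).IsHermitian)
    (β β₀ : ℝ) (θ θ₀ : ι → ℝ) {ℓ₀ : ℝ} {lo hi : ι → ℝ}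
    (hℓ₀ : ℓ₀ ≤ Real.log (partitionFn β₀ (∑ a, ((θ₀ a : ℝ) : ℂ) • D a)).re)
    (hlo : ∀ a, lo a ≤ (gibbsState β₀ (∑ a, ((θ₀ a : ℝ) : ℂ) • D a) (D a)).re)
    (hhi : ∀ a, (gibbsState β₀ (∑ a, ((θ₀ a : ℝ) : ℂ) • D a) (D a)).re ≤ hi a) :
    ℓ₀ - ∑ a, max ((β * θ a - β₀ * θ₀ a) * lo a) ((β * θ a - β₀ * θ₀ a) * hi a) ≤
      Real.log (partitionFn β (∑ a, ((θ a : ℝ) : ℂ) • D a)).re := by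
  refine le_trans ?_ (log_partitionFn_coord_ge_tangent_temperature hD β β₀ θ θ₀)
  have hs : ∑ a, (β * θ a - β₀ * θ₀ a) * (gibbsState β₀ (∑ a, ((θ₀ a : ℝ) : ℂ) • D a) (D a)).re ≤
      ∑ a, max ((β * θ a - β₀ * θ₀ a) * lo a) ((β * θ a - β₀ * θ₀ a) * hi a) :=
    Finset.sum_le_sum fun a _ => by
      rcases le_total 0 (β * θ a - β₀ * θ₀ a) with hd | hd
      · exact (mul_le_mul_of_nonneg_left (hhi a) hd).trans (le_max_right _ _)
      · exact (mul_le_mul_of_nonpos_left (hlo a) hd).trans (le_max_left _ _)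
  linarith

end Coord

/-! ### §4 The `t–t'` Hubbard torus: temperature × coupling tangents and Jensen caps -/

section Hubbard

open HubbardWave0

variable (L : ℕ)

/-- The grand-canonical torus family is LINEAR in `(t, t', U, μ)` (all real `a, b`).
[cite: XuEtAl2024, eq. (1)] -/
theorem hubbardTorusTT'_sub_mu_linear (x y : ℝ × ℝ × ℝ × ℝ) (a b : ℝ) :
    hubbardTorusTT' L (a • x + b • y).1 (a • x + b • y).2.1 (a • x + b • y).2.2.1 -
        (((a • x + b • y).2.2.2 : ℝ) : ℂ) • totalNumber =
      (a : ℂ) • (hubbardTorusTT' L x.1 x.2.1 x.2.2.1 - ((x.2.2.2 : ℝ) : ℂ) • totalNumber) +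
        (b : ℂ) • (hubbardTorusTT' L y.1 y.2.1 y.2.2.1 - ((y.2.2.2 : ℝ) : ℂ) • totalNumber) := by
  simp only [hubbardTorusTT'_eq_smul_add, Prod.smul_fst, Prod.smul_snd, Prod.fst_add, Prod.snd_add,
    smul_eq_mul, Complex.ofReal_add, Complex.ofReal_mul]
  module

/-- **The temperature × coupling tangent plane of the grand-canonical torus**: for every `β, β₀`, anchor
`(t₀,s₀,U₀,μ₀)` and target `(t,s,U,μ)`,
`log Z_{β₀}(anchor) − [(βt−β₀t₀)⟨K₁⟩₀ + (βs−β₀s₀)⟨K₂⟩₀ + (βU−β₀U₀)⟨D⟩₀ − (βμ−β₀μ₀)⟨N⟩₀] ≤ log Z_β(target)`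
(`K₁, K₂, D, N` = unit nearest-neighbour / diagonal hopping Hamiltonians, double occupancy, particle
number; `⟨·⟩₀` the anchor Gibbs state at `β₀`). [cite: Lieb1973, §V (5.2)–(5.4)] -/
theorem log_partitionFn_hubbardTorusTT'_ge_tangent_temperature (β β₀ t s U μ t₀ s₀ U₀ μ₀ : ℝ) :
    Real.log (partitionFn β₀ (hubbardTorusTT' L t₀ s₀ U₀ - (μ₀ : ℂ) • totalNumber)).re -
        ((β * t - β₀ * t₀) * (gibbsState β₀ (hubbardTorusTT' L t₀ s₀ U₀ - (μ₀ : ℂ) • totalNumber)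
            (hamiltonian (fermionTorusGraph 2 L) 1 0)).re +
          (β * s - β₀ * s₀) * (gibbsState β₀ (hubbardTorusTT' L t₀ s₀ U₀ - (μ₀ : ℂ) • totalNumber)
            (hamiltonian (fermionTorusDiagGraph L) 1 0)).re +
          (β * U - β₀ * U₀) * (gibbsState β₀ (hubbardTorusTT' L t₀ s₀ U₀ - (μ₀ : ℂ) • totalNumber)
            (∑ x : FermionTorus 2 L, numberOp x 0 * numberOp x 1)).re -
          (β * μ - β₀ * μ₀) * (gibbsState β₀ (hubbardTorusTT' L t₀ s₀ U₀ - (μ₀ : ℂ) • totalNumber)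
            totalNumber).re) ≤
      Real.log (partitionFn β (hubbardTorusTT' L t s U - (μ : ℂ) • totalNumber)).re := by
  have h := log_partitionFn_linear_ge_tangent_temperature
    (H := fun q : ℝ × ℝ × ℝ × ℝ => hubbardTorusTT' L q.1 q.2.1 q.2.2.1 - ((q.2.2.2 : ℝ) : ℂ) • totalNumber)
    (fun x y a b => hubbardTorusTT'_sub_mu_linear L x y a b)
    (fun q => isHermitian_hubbardTorusTT'_sub_mu L q.1 q.2.1 q.2.2.1 q.2.2.2) β β₀ (t, s, U, μ) (t₀, s₀, U₀, μ₀)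
  simp only at h
  have hW : (β : ℂ) • (hubbardTorusTT' L t s U - (μ : ℂ) • totalNumber) -
      (β₀ : ℂ) • (hubbardTorusTT' L t₀ s₀ U₀ - (μ₀ : ℂ) • totalNumber) =
      ((β * t - β₀ * t₀ : ℝ) : ℂ) • hamiltonian (fermionTorusGraph 2 L) 1 0 +
        ((β * s - β₀ * s₀ : ℝ) : ℂ) • hamiltonian (fermionTorusDiagGraph L) 1 0 +
          ((β * U - β₀ * U₀ : ℝ) : ℂ) • (∑ x : FermionTorus 2 L, numberOp x 0 * numberOp x 1) -
            ((β * μ - β₀ * μ₀ : ℝ) : ℂ) • totalNumber := by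
    simp only [hubbardTorusTT'_eq_smul_add, Complex.ofReal_sub, Complex.ofReal_mul]
    module
  rw [hW, map_sub, map_add, map_add, map_smul, map_smul, map_smul, map_smul, smul_eq_mul, smul_eq_mul,
    smul_eq_mul, smul_eq_mul, Complex.sub_re, Complex.add_re, Complex.add_re, Complex.re_ofReal_mul,
    Complex.re_ofReal_mul, Complex.re_ofReal_mul, Complex.re_ofReal_mul] at h
  exact h

/-- **Jensen caps over a temperature × coupling cell of the torus**: corners `(βₖ; tₖ,sₖ,Uₖ,μₖ)` with
`log Z_{βₖ} ≤ uₖ`, convex weights, and a target `(β; q)` whose scaled couplings are the barycentre of the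
scaled corners (`β • q = Σ wₖ • (βₖ • qₖ)` in `ℝ⁴`) give `log Z_β(H_L(q) − μN) ≤ Σ wₖ uₖ`.
[cite: Israel1979, Thm. I.3.4] -/
theorem log_partitionFn_hubbardTorusTT'_le_sum_temperature {κ : Type*} (S : Finset κ) (w : κ → ℝ)
    (βk : κ → ℝ) (qk : κ → ℝ × ℝ × ℝ × ℝ) (u : κ → ℝ) (hw : ∀ k ∈ S, 0 ≤ w k) (hw1 : ∑ k ∈ S, w k = 1)
    {β : ℝ} {q : ℝ × ℝ × ℝ × ℝ} (hc : β • q = ∑ k ∈ S, w k • (βk k • qk k))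
    (hu : ∀ k ∈ S, Real.log (partitionFn (βk k)
      (hubbardTorusTT' L (qk k).1 (qk k).2.1 (qk k).2.2.1 - (((qk k).2.2.2 : ℝ) : ℂ) • totalNumber)).re ≤ u k) :
    Real.log (partitionFn β (hubbardTorusTT' L q.1 q.2.1 q.2.2.1 - ((q.2.2.2 : ℝ) : ℂ) • totalNumber)).re ≤
      ∑ k ∈ S, w k * u k :=
  log_partitionFn_linear_le_sum_of_le_temperature
    (H := fun q : ℝ × ℝ × ℝ × ℝ => hubbardTorusTT' L q.1 q.2.1 q.2.2.1 - ((q.2.2.2 : ℝ) : ℂ) • totalNumber)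
    (fun x y a b => hubbardTorusTT'_sub_mu_linear L x y a b)
    (fun q => isHermitian_hubbardTorusTT'_sub_mu L q.1 q.2.1 q.2.2.1 q.2.2.2) S w βk qk u hw hw1 hc hu

/-- The canonical-sector family is LINEAR in `(t, t', U)` (all real `a, b`). [cite: XuEtAl2024, eq. (1)] -/
theorem sectorHamiltonianTT'_linear (nf : ℝ) (x y : ℝ × ℝ × ℝ) (a b : ℝ) :
    sectorHamiltonianTT' (a • x + b • y).1 (a • x + b • y).2.1 (a • x + b • y).2.2 nf L =
      (a : ℂ) • sectorHamiltonianTT' x.1 x.2.1 x.2.2 nf L +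
        (b : ℂ) • sectorHamiltonianTT' y.1 y.2.1 y.2.2 nf L := by
  simp only [sectorHamiltonianTT'_eq_smul_add, Prod.smul_fst, Prod.smul_snd, Prod.fst_add, Prod.snd_add,
    smul_eq_mul, Complex.ofReal_add, Complex.ofReal_mul]
  module

/-- **The temperature × coupling tangent plane of the canonical sector** (`0 ≤ n ≤ 2`):
`log Z_{β₀}(anchor) − [(βt−β₀t₀)⟨K₁|_s⟩₀ + (βs−β₀s₀)⟨K₂|_s⟩₀ + (βU−β₀U₀)⟨D|_s⟩₀] ≤ log Z_β(target)`.
[cite: Lieb1973, §V (5.2)–(5.4)] -/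
theorem log_partitionFn_sectorHamiltonianTT'_ge_tangent_temperature {nf : ℝ} (hn0 : 0 ≤ nf) (hn2 : nf ≤ 2)
    (β β₀ t s U t₀ s₀ U₀ : ℝ) :
    Real.log (partitionFn β₀ (sectorHamiltonianTT' t₀ s₀ U₀ nf L)).re -
        ((β * t - β₀ * t₀) * (gibbsState β₀ (sectorHamiltonianTT' t₀ s₀ U₀ nf L)
            ((hamiltonian (fermionTorusGraph 2 L) 1 0).submatrix
              (Subtype.val : Subtype (szConfig nf L) → _) Subtype.val)).re +
          (β * s - β₀ * s₀) * (gibbsState β₀ (sectorHamiltonianTT' t₀ s₀ U₀ nf L)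
            ((hamiltonian (fermionTorusDiagGraph L) 1 0).submatrix
              (Subtype.val : Subtype (szConfig nf L) → _) Subtype.val)).re +
          (β * U - β₀ * U₀) * (gibbsState β₀ (sectorHamiltonianTT' t₀ s₀ U₀ nf L)
            ((∑ x : FermionTorus 2 L, numberOp x 0 * numberOp x 1).submatrix
              (Subtype.val : Subtype (szConfig nf L) → _) Subtype.val)).re) ≤
      Real.log (partitionFn β (sectorHamiltonianTT' t s U nf L)).re := by
  haveI := nonempty_szConfig hn0 hn2 L
  have h := log_partitionFn_linear_ge_tangent_temperature
    (H := fun q : ℝ × ℝ × ℝ => sectorHamiltonianTT' q.1 q.2.1 q.2.2 nf L)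
    (fun x y a b => sectorHamiltonianTT'_linear L nf x y a b)
    (fun q => isHermitian_sectorHamiltonianTT' q.1 q.2.1 q.2.2 nf L) β β₀ (t, s, U) (t₀, s₀, U₀)
  simp only at h
  have hW : (β : ℂ) • sectorHamiltonianTT' t s U nf L - (β₀ : ℂ) • sectorHamiltonianTT' t₀ s₀ U₀ nf L =
      ((β * t - β₀ * t₀ : ℝ) : ℂ) • (hamiltonian (fermionTorusGraph 2 L) 1 0).submatrix
          (Subtype.val : Subtype (szConfig nf L) → _) Subtype.val +
        ((β * s - β₀ * s₀ : ℝ) : ℂ) • (hamiltonian (fermionTorusDiagGraph L) 1 0).submatrix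
          (Subtype.val : Subtype (szConfig nf L) → _) Subtype.val +
          ((β * U - β₀ * U₀ : ℝ) : ℂ) • (∑ x : FermionTorus 2 L, numberOp x 0 * numberOp x 1).submatrix
            (Subtype.val : Subtype (szConfig nf L) → _) Subtype.val := by
    simp only [sectorHamiltonianTT'_eq_smul_add, Complex.ofReal_sub, Complex.ofReal_mul]
    module
  rw [hW, map_add, map_add, map_smul, map_smul, map_smul, smul_eq_mul, smul_eq_mul, smul_eq_mul,
    Complex.add_re, Complex.add_re, Complex.re_ofReal_mul, Complex.re_ofReal_mul, Complex.re_ofReal_mul] at h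
  exact h

/-- **Jensen caps over a temperature × coupling cell of the canonical sector** (`0 ≤ n ≤ 2`): corner caps
`log Z_{βₖ}(H_L(qₖ)|_s) ≤ uₖ` and `β • q = Σ wₖ • (βₖ • qₖ)` in `ℝ³` give `log Z_β(H_L(q)|_s) ≤ Σ wₖ uₖ` —
with the `T > 0` crew's per-volume normalisation, free-energy FLOORS on the whole cell from corner
certificates. [cite: Israel1979, Thm. I.3.4] -/
theorem log_partitionFn_sectorHamiltonianTT'_le_sum_temperature {nf : ℝ} (hn0 : 0 ≤ nf) (hn2 : nf ≤ 2)
    {κ : Type*} (S : Finset κ) (w : κ → ℝ) (βk : κ → ℝ) (qk : κ → ℝ × ℝ × ℝ) (u : κ → ℝ)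
    (hw : ∀ k ∈ S, 0 ≤ w k) (hw1 : ∑ k ∈ S, w k = 1) {β : ℝ} {q : ℝ × ℝ × ℝ}
    (hc : β • q = ∑ k ∈ S, w k • (βk k • qk k))
    (hu : ∀ k ∈ S, Real.log (partitionFn (βk k)
      (sectorHamiltonianTT' (qk k).1 (qk k).2.1 (qk k).2.2 nf L)).re ≤ u k) :
    Real.log (partitionFn β (sectorHamiltonianTT' q.1 q.2.1 q.2.2 nf L)).re ≤ ∑ k ∈ S, w k * u k := by
  haveI := nonempty_szConfig hn0 hn2 L
  exact log_partitionFn_linear_le_sum_of_le_temperature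
    (H := fun q : ℝ × ℝ × ℝ => sectorHamiltonianTT' q.1 q.2.1 q.2.2 nf L)
    (fun x y a b => sectorHamiltonianTT'_linear L nf x y a b)
    (fun q => isHermitian_sectorHamiltonianTT' q.1 q.2.1 q.2.2 nf L) S w βk qk u hw hw1 hc hu

end Hubbard

end Literature.MathematicalPhysics.QuantumLattice
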